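import Summits.HodgeConjecture.HodgeConjecture.Theorems.MarkmanPartnerTransportPartnerTransportInverse
import Summits.HodgeConjecture.HodgeConjecture.Theorems.MarkmanPartnerTransportPartnerExistenceLatticeTransc
import Mathlib.LinearAlgebra.Projection

/-!
# Route MarkmanPartnerTransport · support #3 `IsometrySpannedThird` — the TRANSCENDENTAL PROJECTOR of a
# marked `K3^{[2]}`-type fourfold: `H²(X) = N¹(X) ⊕ T(X)`, `π_T` rational, Hodge, `q`-self-adjoint

For a marked smooth projective fourfold `(X, φ, P, z)` the `q`-orthogonal projection `π_T` of `H²(X(ℂ); ℂ)`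
onto the `q`-transcendental classes `T(X)` along `N¹(X)` exists and is: zero on `N¹(X)`, the identity on
`T(X)`, with image in `T(X)` and `y − π_T y ∈ N¹(X)`; RATIONAL (it is the complexification of the rational
projection `ℚ²³ = N_ℚ ⊕ T_ℚ`, `…PartnerExistenceLattice`); `q`-SELF-ADJOINT; and HODGE (`(2,0)`-classes are
transcendental, `(1,1)` minus algebraic is `(1,1)`, `(0,2)` by conjugation).  Ingredient of the partner-free
treatment of the `E = ℚ` third (seat notes, gen 6).

* `exists_transcendentalProjector`.

No definition, no sorry, no named fact. Prover seat hodge-nonav-19652-p1 (gen 6), `--supports stmt-HodgeConjecture-19651`.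

References: D. Huybrechts, *Lectures on K3 Surfaces* Ch. 3 Def. 2.5, Lemma 3.1; A. Beauville, J. Differential
Geom. 18 (1983) §8–9; C. Voisin, *Hodge Theory I* §7.1.
-/

noncomputable section

set_option linter.dupNamespace false

open scoped Matrix
open Module CategoryTheory
open Literature.AlgebraicTopology.SingularHomology Literature.Geometry.Kaehler
open Literature.AlgebraicGeometry Literature.AlgebraicGeometry.Motives Literature.AlgebraicGeometry.HodgeTheory
open Literature.AlgebraicGeometry.Hyperkaehler Literature.AlgebraicGeometry.Surfaces
open Summit.HodgeConjecture.HodgeConjecture.Theorems.NikulinTwinTransport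
open Summit.HodgeConjecture.HodgeConjecture.Theorems.MarkmanPartnerTransport.BBFPositivity

namespace Summit.HodgeConjecture.HodgeConjecture.Theorems.MarkmanPartnerTransport.PartnerLattice

/-- `MarkedK3Sq[X, φ, P, z]`: VERBATIM the `let MarkedK3Sq := …` binder of the route declarations of
MarkmanPartnerTransport (clauses (m1)–(m6)). Local notation only. -/
local notation3 (prettyPrint := false) "MarkedK3Sq[" X ", " φ ", " P ", " z "]" =>
  (((IsIntegralClass P ∧ ∀ Q : complexBetti X (2 * 4), IsIntegralClass Q → ∃ n : ℤ, Q = n • P) ∧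
    (∀ c : complexBetti X 2, IsIntegralClass c ↔ ∃ v : K3HilbertIndex → ℤ, φ c = fun i => (v i : ℂ)) ∧
    (∀ a : complexBetti X 2, cupPowTwo a 4 = ((3 : ℂ) * (k3HilbertForm 2 (φ a) (φ a)) ^ 2) • P) ∧
    (IsOfHodgeType 4 X 2 2 0 (LinearEquiv.symm φ z) ∧
      ∀ τ : complexBetti X 2, IsOfHodgeType 4 X 2 2 0 τ → ∃ t : ℂ, τ = t • LinearEquiv.symm φ z) ∧
    (∀ c : complexBetti X 2, IsOfHodgeType 4 X 2 1 1 c ↔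
      (k3HilbertForm 2 (φ c) z = 0 ∧ k3HilbertForm 2 (φ c) (star z) = 0)) ∧
    (k3HilbertForm 2 z z = 0 ∧ 0 < (k3HilbertForm 2 (star z) z).re)))

/-- `qQ` = the rational Beauville–Bogomolov form of `K3^{[2]}`-type on `ℚ²³`. Local notation only. -/
local notation3 (prettyPrint := false) "qQ" => Matrix.toBilin' (Matrix.map (k3HilbertGram 2) (Int.cast : ℤ → ℚ))

/-- `cz[τ]` = the complexification of a `ℚ`-linear `τ : ℚ²³ → ℚ²³`. Local notation only. -/
local notation3 (prettyPrint := false) "cz[" τ "]" =>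
  Matrix.toLin' (Matrix.map (LinearMap.toMatrix' (R := ℚ) τ) (Rat.cast : ℚ → ℂ))

variable {X : SchemeOver ℂ} {φ : complexBetti X 2 ≃ₗ[ℂ] (K3HilbertIndex → ℂ)} {P : complexBetti X (2 * 4)}
  {z : K3HilbertIndex → ℂ}

/-- The complexification of a rational endomorphism which is `qQ`-self-adjoint is `q`-self-adjoint on `ℂ²³`
(the bilinear identity holds on the rational standard basis). [folklore] -/
theorem k3HilbertForm_cplx_selfAdjoint (τ : (K3HilbertIndex → ℚ) →ₗ[ℚ] (K3HilbertIndex → ℚ))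
    (hτ : ∀ v w, qQ (τ v) w = qQ v (τ w)) (a b : K3HilbertIndex → ℂ) :
    k3HilbertForm 2 (cz[τ] a) b = k3HilbertForm 2 a (cz[τ] b) := by
  set B₁ : LinearMap.BilinForm ℂ (K3HilbertIndex → ℂ) :=
    (Matrix.toBilin' (Matrix.map (k3HilbertGram 2) (Int.cast : ℤ → ℂ))).compl₁₂ cz[τ] LinearMap.id with hB₁
  set B₂ : LinearMap.BilinForm ℂ (K3HilbertIndex → ℂ) :=
    (Matrix.toBilin' (Matrix.map (k3HilbertGram 2) (Int.cast : ℤ → ℂ))).compl₁₂ LinearMap.id cz[τ] with hB₂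
  have hB : B₁ = B₂ := by
    refine (Pi.basisFun ℂ K3HilbertIndex).ext fun i => (Pi.basisFun ℂ K3HilbertIndex).ext fun j => ?_
    have hi : (Pi.basisFun ℂ K3HilbertIndex) i = fun k => ((Pi.single i (1 : ℚ) : K3HilbertIndex → ℚ) k : ℂ) := by
      funext k; by_cases hk : k = i <;> simp [Pi.basisFun_apply, hk]
    have hj : (Pi.basisFun ℂ K3HilbertIndex) j = fun k => ((Pi.single j (1 : ℚ) : K3HilbertIndex → ℚ) k : ℂ) := by
      funext k; by_cases hk : k = j <;> simp [Pi.basisFun_apply, hk]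
    rw [hB₁, hB₂, LinearMap.compl₁₂_apply, LinearMap.compl₁₂_apply, LinearMap.id_apply, LinearMap.id_apply,
      hi, hj, cplx_ratCast, cplx_ratCast, qC_apply, qC_apply, k3HilbertForm_ratCast, k3HilbertForm_ratCast, hτ]
  have h := LinearMap.congr_fun₂ hB a b
  rw [hB₁, hB₂, LinearMap.compl₁₂_apply, LinearMap.compl₁₂_apply, LinearMap.id_apply, LinearMap.id_apply,
    qC_apply, qC_apply] at h
  exact h

/-- **The transcendental projector `π_T` of a marked `K3^{[2]}`-type fourfold** (module docstring): a
`ℂ`-linear endomorphism of `H²(X)` vanishing on `N¹(X)`, fixing every `q`-transcendental class, with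
`q`-transcendental image and `y − π_T y ∈ N¹(X)`, rational, `q`-self-adjoint and type-preserving.
[cite: Huybrechts2016K3, Ch. 3 Def. 2.5 and Lemma 3.1] [cite: VoisinHodgeI2002, §7.1.1 and Thm. 11.30] -/
theorem exists_transcendentalProjector (hX : IsSmoothProjective 4 X) (hM : MarkedK3Sq[X, φ, P, z]) :
    ∃ πT : complexBetti X 2 →ₗ[ℂ] complexBetti X 2,
      (∀ d ∈ algebraicClasses X 1, πT d = 0) ∧
      (∀ y : complexBetti X 2, (∀ d ∈ algebraicClasses X 1, k3HilbertForm 2 (φ y) (φ d) = 0) → πT y = y) ∧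
      (∀ y : complexBetti X 2, ∀ d ∈ algebraicClasses X 1, k3HilbertForm 2 (φ (πT y)) (φ d) = 0) ∧
      (∀ y : complexBetti X 2, y - πT y ∈ algebraicClasses X 1) ∧
      (∀ y, IsRationalClass y → IsRationalClass (πT y)) ∧
      (∀ y w, k3HilbertForm 2 (φ (πT y)) (φ w) = k3HilbertForm 2 (φ y) (φ (πT w))) ∧
      (∀ (i j : ℕ) y, IsOfHodgeType 4 X 2 i j y → IsOfHodgeType 4 X 2 i j (πT y)) := by
  classical
  obtain ⟨-, hint, -, ⟨hz20, hz20span⟩, h11, -⟩ := id hM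
  obtain ⟨NQ, hNQ⟩ := exists_ratNeronSeveri (X := X) φ
  set TQ : Submodule ℚ (K3HilbertIndex → ℚ) := (qQ).orthogonal NQ with hTQdef
  have hc : IsCompl TQ NQ := (isCompl_ratNeronSeveri_orthogonal hX hM hNQ).symm
  -- the rational projection onto `T_ℚ` along `N_ℚ`
  set pT : (K3HilbertIndex → ℚ) →ₗ[ℚ] (K3HilbertIndex → ℚ) := TQ.projection NQ hc with hpTdef
  have hpT_T : ∀ t ∈ TQ, pT t = t := fun t ht => Submodule.projection_apply_of_mem_left hc ht
  have hpT_N : ∀ n ∈ NQ, pT n = 0 := fun n hn => Submodule.projection_apply_of_mem_right hc hn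
  have hpT_mem : ∀ v, pT v ∈ TQ := fun v => Submodule.projection_apply_mem hc v
  have hpT_sub : ∀ v, v - pT v ∈ NQ := by
    intro v
    have hv : v ∈ TQ ⊔ NQ := by rw [hc.sup_eq_top]; exact Submodule.mem_top
    obtain ⟨t, ht, n, hn, rfl⟩ := Submodule.mem_sup.1 hv
    rw [map_add, hpT_T t ht, hpT_N n hn, add_zero, add_sub_cancel_left]
    exact hn
  have hpT_adj : ∀ v w, qQ (pT v) w = qQ v (pT w) := by
    intro v w
    -- `q(pT v, w) = q(pT v, pT w) = q(v, pT w)` since `T_ℚ ⟂ N_ℚ ∋ w - pT w, v - pT v`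
    have h1 : qQ (pT v) (w - pT w) = 0 := by
      have := (LinearMap.BilinForm.mem_orthogonal_iff.1 (hpT_mem v)) _ (hpT_sub w)
      rw [qQ_comm]; exact this
    have h2 : qQ (v - pT v) (pT w) = 0 :=
      (LinearMap.BilinForm.mem_orthogonal_iff.1 (hpT_mem w)) _ (hpT_sub v)
    rw [map_sub, LinearMap.sub_apply, sub_eq_zero] at h2
    rw [map_sub, sub_eq_zero] at h1
    rw [h1, h2]
  -- the complex projector
  set πT : complexBetti X 2 →ₗ[ℂ] complexBetti X 2 :=
    (φ.symm : (K3HilbertIndex → ℂ) →ₗ[ℂ] complexBetti X 2) ∘ₗ cz[pT] ∘ₗ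
      (φ : complexBetti X 2 →ₗ[ℂ] (K3HilbertIndex → ℂ)) with hπTdef
  have hπT : ∀ y, φ (πT y) = cz[pT] (φ y) := fun y => by
    rw [hπTdef, LinearMap.comp_apply, LinearMap.comp_apply, LinearEquiv.coe_coe, LinearEquiv.coe_coe,
      LinearEquiv.apply_symm_apply]
  -- `N¹(X)` and `T(X)` in the marking
  have hNspan := span_ratNeronSeveri hX hint hNQ
  have hN_mem : ∀ d ∈ algebraicClasses X 1, φ d ∈ Submodule.span ℂ
      ((fun a : K3HilbertIndex → ℚ => fun i => (a i : ℂ)) '' (NQ : Set (K3HilbertIndex → ℚ))) := by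
    intro d hd
    rw [hNspan, Submodule.mem_map_equiv, LinearEquiv.symm_apply_apply]
    exact hd
  have hN_of_mem : ∀ u ∈ Submodule.span ℂ
      ((fun a : K3HilbertIndex → ℚ => fun i => (a i : ℂ)) '' (NQ : Set (K3HilbertIndex → ℚ))),
      φ.symm u ∈ algebraicClasses X 1 := by
    intro u hu
    rw [hNspan, Submodule.mem_map_equiv] at hu
    exact hu
  have hT_iff := fun y => mem_span_ratTransc_iff hX hint hNQ (φ y)
  -- (1) zero on `N¹(X)`
  have h1 : ∀ d ∈ algebraicClasses X 1, πT d = 0 := by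
    intro d hd
    apply φ.injective
    rw [hπT, map_zero]
    have := eq_on_span_ratCast cz[pT] 0 _ (fun n hn => by
      rw [cplx_ratCast, hpT_N n hn, LinearMap.zero_apply]; funext i; simp) (hN_mem d hd)
    rwa [LinearMap.zero_apply] at this
  -- (2) identity on `T(X)`
  have h2 : ∀ y : complexBetti X 2, (∀ d ∈ algebraicClasses X 1, k3HilbertForm 2 (φ y) (φ d) = 0) →
      πT y = y := by
    intro y hy
    apply φ.injective
    rw [hπT]
    have := eq_on_span_ratCast cz[pT] LinearMap.id _ (fun t ht => by
      rw [cplx_ratCast, hpT_T t ht, LinearMap.id_apply]) ((hT_iff y).2 hy)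
    rwa [LinearMap.id_apply] at this
  -- (3) image in `T(X)`
  have h3 : ∀ y : complexBetti X 2, ∀ d ∈ algebraicClasses X 1, k3HilbertForm 2 (φ (πT y)) (φ d) = 0 := by
    intro y
    rw [hπT]
    exact (mem_span_ratTransc_iff hX hint hNQ _).1 (cplx_mem_span pT TQ hpT_mem (φ y))
  -- (4) `y - πT y ∈ N¹(X)`
  have h4 : ∀ y : complexBetti X 2, y - πT y ∈ algebraicClasses X 1 := by
    intro y
    have hmem : cz[LinearMap.id - pT] (φ y) ∈ Submodule.span ℂ
        ((fun a : K3HilbertIndex → ℚ => fun i => (a i : ℂ)) '' (NQ : Set (K3HilbertIndex → ℚ))) :=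
      cplx_mem_span (LinearMap.id - pT) NQ (fun v => hpT_sub v) (φ y)
    have hsub : cz[LinearMap.id - pT] (φ y) = φ y - cz[pT] (φ y) := by
      have h := eq_on_span_ratCast cz[LinearMap.id - pT] (LinearMap.id - cz[pT]) _ (fun r _ => by
        simp only [cplx_ratCast, LinearMap.sub_apply, LinearMap.id_apply]
        funext i
        simp [Rat.cast_sub]) (mem_span_ratCast_top (φ y))
      rw [h, LinearMap.sub_apply, LinearMap.id_apply]
    have h := hN_of_mem _ hmem
    rwa [hsub, ← hπT, ← map_sub, LinearEquiv.symm_apply_apply] at h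
  -- (5) rationality
  have h5 : ∀ y, IsRationalClass y → IsRationalClass (πT y) := by
    intro y hy
    obtain ⟨w, hw⟩ := (isRationalClass_iff_of_markedSq hX hint y).1 hy
    exact (isRationalClass_iff_of_markedSq hX hint _).2 ⟨pT w, by rw [hπT, hw, cplx_ratCast]⟩
  -- (6) self-adjointness
  have h6 : ∀ y w, k3HilbertForm 2 (φ (πT y)) (φ w) = k3HilbertForm 2 (φ y) (φ (πT w)) := by
    intro y w
    rw [hπT, hπT]
    exact k3HilbertForm_cplx_selfAdjoint pT hpT_adj _ _
  -- (7) Hodge types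
  have hσT : ∀ d ∈ algebraicClasses X 1, k3HilbertForm 2 (φ (φ.symm z)) (φ d) = 0 := by
    intro d hd
    rw [LinearEquiv.apply_symm_apply, k3HilbertForm_comm]
    exact ((h11 d).1 (isOfHodgeType_of_mem_algebraicClasses_of_isSmoothProjective hX 1 hd)).1
  have hconj : ∀ c, πT (conjClass (ComplexPoints X) 2 c) = conjClass (ComplexPoints X) 2 (πT c) :=
    conjClass_map_of_isRationalClass hX hX hint hint πT h5
  have h20T : ∀ y, IsOfHodgeType 4 X 2 2 0 y → IsOfHodgeType 4 X 2 2 0 (πT y) := by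
    intro y hy
    obtain ⟨t, rfl⟩ := hz20span y hy
    rw [map_smul, h2 _ hσT]
    exact hz20.smul t
  have h7 : ∀ (i j : ℕ) y, IsOfHodgeType 4 X 2 i j y → IsOfHodgeType 4 X 2 i j (πT y) := by
    intro i j y hy
    by_cases hij : i + j = 2
    · have hi2 : i ≤ 2 := by omega
      interval_cases i
      · have hj : j = 2 := by omega
        subst hj
        rw [← conjClass_conjClass (πT y), ← hconj]
        exact (h20T _ (hy.conjClass hX)).conjClass hX
      · have hj : j = 1 := by omega
        subst hj
        have hsub : πT y = y - (y - πT y) := by abel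
        rw [hsub]
        exact hy.sub hX (isOfHodgeType_of_mem_algebraicClasses_of_isSmoothProjective hX 1 (h4 y))
      · have hj : j = 0 := by omega
        subst hj
        exact h20T y hy
    · have hy0 : y = 0 := by
        obtain ⟨A, hA⟩ := hy
        rw [(A.hodgePQ_eq_bot_iff 2 i j).2
            (Literature.NumberTheory.Transcendental.hodgePQ_eq_bot_of_ne (M := A.carrier) hij),
          Submodule.mem_bot] at hA
        exact A.pullback_injective 2 (by rw [hA, map_zero])
      rw [hy0, map_zero]
      exact isOfHodgeType_zero_of_isSmoothProjective nonempty_hodgeModel_holds hX 2 i j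
  exact ⟨πT, h1, h2, h3, h4, h5, h6, h7⟩

end Summit.HodgeConjecture.HodgeConjecture.Theorems.MarkmanPartnerTransport.PartnerLattice

end
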